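import Summits.BirchSwinnertonDyer.BirchSwinnertonDyer.Theorems.GoldfeldAllTwistsTwoConverseTwinHalfTraceSevenModEightShimuraTransport
import Summits.BirchSwinnertonDyer.BirchSwinnertonDyer.Theorems.GoldfeldAllTwistsTwoConverseTwinHalfTraceSevenModEightRankOne
import Summits.BirchSwinnertonDyer.BirchSwinnertonDyer.Theorems.GoldfeldAllTwistsTwoConverseTwinHalfTraceSevenModEightCore
import Summits.BirchSwinnertonDyer.BirchSwinnertonDyer.Theorems.GoldfeldAllTwistsTwoConverseTwinGenusSquaresEven
import Summits.BirchSwinnertonDyer.BirchSwinnertonDyer.Theorems.GoldfeldAllTwistsTwoConverseTwinGenusHeightRatioNegTwo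
import Literature.NumberTheory.EllipticCurves.HeegnerPointsGenusHalfTraceProofs
import Literature.NumberTheory.EllipticCurves.HeegnerPointsClassesProofs
import Literature.NumberTheory.EllipticCurves.CuspFormLValueSeries
import Literature.NumberTheory.QuadraticFields.AmbiguousClassesOrder
import HarnessLib

set_option linter.dupNamespace false
set_option autoImplicit false

/-!
# LINE B49, family F3 (`d_K = −8ℓ`, `ℓ ≡ 7 (mod 8)`): the HALF-TRACE CONJUGATION LAW `Ψ⁻ + τΨ⁻ = O` in `X₀(49)(K[1])`
# (hypothesis (H2) of THEOREM A″, `…TwinHalfTraceSevenModEightAssembly`) — discharged from print and the tree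

Cell `bsd-goldfeld`, seat `bsd-goldfeld-s1p-c3x` (prover, gen 0; second lane on item `stmt-BirchSwinnertonDyer-19350`, instruction
of record `HOME/LANE-BRIEF-S1P-C3X.md` §2 file 4, Gross half), `--supports stmt-BirchSwinnertonDyer-19350`. Theses-free; theorems
only; NO definition, NO fact. HONEST FRAMING: BSD is not proved here; the two named inputs are the root number `w(49a1) = +1`
(`hw`, = `rootNumber_cm7 h12`) and the cusp value (T-φ0) `φ₀(0) = T` (`h0`, verbatim shape of `x049_cuspZeroPoint_eq_twoTorsion`;
= seat c3's `x049_cuspZeroPoint_eq_twoTorsion_holds_of_thm12` given `h12`). Everything else is PROVED in the tree and only CITED: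
Shimura reciprocity (ty, `heegnerPoints_shimuraReciprocity_holds`, read in `K[1]` by `exists_shimuraReciprocity_ringClassField_one`),
Gross's summed reflection law over a coset of the squares (ty's FILE D `conjPoint_sum_φ_heegnerTau_sqCoset`, with `[𝔫] = [𝔮₇]²`
from `heegnerFormClass_levelForm_eq_sq`), and the parity «`#Cl(−8ℓ)²` is EVEN» (seat c3, GENUS-SQUARES-EVEN p539038,
`even_natCard_range_powMonoidHom_two_of_discr_eq_neg_eight_mul`, BOUND BY NAME, not rebuilt).

## The argument (Gross 1984 §5 / Gross 1991 Prop. 5.3, summed; c3 g11 scoping memo §2 step (5))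

`K = ℚ(√−2ℓ)`, `r₀ = √−ℓ ∈ K[1]`, `G = Gal(K[1]/K) ≅ Cl = Cl(𝒪_{−8ℓ})` (Artin, `Θ`), `y₁ = y(1) = P_{q₁}` the conductor-one Heegner
point, `Ψ⁻ = Σ_{σ ∈ G, σr₀ = −r₀} σy₁`. By `algEquiv_apply_sqrt_eq_iff_symm_mem_range_sq`, `σ r₀ = −r₀ ⟺ Θ⁻¹σ ∉ Cl²
⟺ Θ⁻¹σ ∈ Cl²γ₁` (`[Cl : Cl²] = 2`), so in `E(ℂ)`: `Ψ⁻ = Σ_{[𝔞_Q] ∈ Cl²·γ₁[𝔞_{q₁}]} φ(τ_Q) =: z` (translation law, class bijection on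
representatives). FILE D: `z̄ = −z + #(Cl²γ₀)·φ(0)` (Fricke sign `−w = −1`), and `#(Cl²γ₀) = #Cl²` is EVEN while `2φ(0) = 2T = O`:
`z̄ = −z`. Complex conjugation `τ` of `K[1] ⊂ ℂ` acts on `E(K[1]) ⊂ E(ℂ)` as `z ↦ z̄`; injectivity of `E(K[1]) → E(ℂ)` gives
`Ψ⁻ + τΨ⁻ = O` (`halfTrace_add_map_conj_eq_zero_negEightPrime`).

References: B. Gross, *Heegner points on X₀(N)* (1984) §5 [Gross1984]; B. Gross, LMS LN 153 (1991) Prop. 5.3 [GrossLMS1991];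
H. Darmon, CBMS 101 (2004) Thm 3.7, Prop. 3.11 [Darmon2004]; D. Cox, *Primes of the form x² + ny²* (2013) Thm 3.15 [Cox2013].
-/

noncomputable section

open scoped Classical

open WeierstrassCurve Literature.NumberTheory.EllipticCurves Literature.NumberTheory.EllipticCurves.ModularForms
  Literature.NumberTheory.EllipticCurves.CoatesLiTianZhai2015 Literature.Computability.Cryptography.Hallgren2005

namespace Summit.BirchSwinnertonDyer.BirchSwinnertonDyer.Theorems.GoldfeldGoodTwists

/-! ## §1 Counting: representatives in a coset of the squares -/

section Counting

variable {K : Type} [Field K] [NumberField K] {N : ℕ} [NeZero N]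

/-- **`#{Q ∈ H.reps : [𝔞_Q] ∈ Cl²γ₀} = #(Cl²γ₀) = #Cl²`**: `Q ↦ [𝔞_Q]` is a bijection `H.reps → Cl(𝒪_{d_K})` (injective on
representatives; surjective by Shimura reciprocity, ty's `heegnerFormClass_bijective`), and translation by `γ₀` is a bijection
`Cl² → Cl²γ₀`. [cite: Gross1984, §I.1] [cite: Cox2013, §3.B Thm. 3.15] -/
theorem card_filter_sqCoset_eq_natCard_range {W : WeierstrassCurve ℚ} [W.IsElliptic] (hK : IsImaginaryQuadratic K)
    (hH : SatisfiesHeegnerHypothesis N K) (Dt : ModularParametrizationData W N) (H : HeegnerDatum N (NumberField.discr K))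
    (ι : K →+* ℂ) (γ₀ : ClassGroup (OrderCl.QO hK.negDiscr)) :
    (H.reps.filter (fun Q ↦ ∃ δ, heegnerFormClass hK Q = δ ^ 2 * γ₀)).card =
      Nat.card (powMonoidHom 2 : ClassGroup (OrderCl.QO hK.negDiscr) →* ClassGroup (OrderCl.QO hK.negDiscr)).range := by
  have hbij := heegnerPoints_shimuraReciprocity.heegnerFormClass_bijective
    (heegnerPoints_shimuraReciprocity_holds N W K) hK hH Dt H ι
  haveI : Finite (ClassGroup (OrderCl.QO hK.negDiscr)) := Finite.of_surjective _ hbij.2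
  -- the filter, as a subtype of `H.reps`, is in bijection with the coset, which is in bijection with `Cl²`
  rw [← Fintype.card_coe, ← Nat.card_eq_fintype_card]
  refine Nat.card_congr ?_
  refine Equiv.ofBijective (fun Q ↦ ⟨heegnerFormClass hK (Q : ℤ × ℤ × ℤ) * γ₀⁻¹, ?_⟩) ⟨?_, ?_⟩
  · obtain ⟨δ, hδ⟩ := (Finset.mem_filter.mp Q.2).2
    exact ⟨δ, by rw [powMonoidHom_apply, hδ, mul_inv_cancel_right]⟩
  · rintro ⟨Q, hQ⟩ ⟨Q', hQ'⟩ h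
    have h' := mul_right_cancel (congrArg Subtype.val h)
    exact Subtype.ext (heegnerFormClass_injOn_reps hK H (Finset.mem_filter.mp hQ).1 (Finset.mem_filter.mp hQ').1 h')
  · rintro ⟨c, δ, hδ⟩
    obtain ⟨q, hq⟩ := hbij.2 (c * γ₀)
    refine ⟨⟨q, Finset.mem_filter.mpr ⟨q.2, δ, ?_⟩⟩, Subtype.ext ?_⟩
    · rw [← powMonoidHom_apply, hδ]; exact hq
    · show heegnerFormClass hK (q : ℤ × ℤ × ℤ) * γ₀⁻¹ = c
      rw [show heegnerFormClass hK (q : ℤ × ℤ × ℤ) = c * γ₀ from hq, mul_inv_cancel_right]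

end Counting

/-! ## §2 The half-trace conjugation law (H2) -/

section HalfTrace

variable {K : Type} [Field K] [NumberField K]

/-- `r₀² = −ℓ` read over `K` inside `K[1]`. [folklore] -/
theorem sq_eq_algebraMap_neg_natCast {ι : K →+* ℂ} {l : ℕ} {r₀ : ringClassField K ι 1} (hr : (r₀ : ℂ) ^ 2 = -(l : ℂ)) :
    r₀ ^ 2 = algebraMap K (ringClassField K ι 1) (-(l : K)) := by
  apply Subtype.ext
  rw [map_neg, map_natCast]
  push_cast
  exact hr

/-- Complex conjugation of `K[1] ⊂ ℂ` acts on `E(K[1]) ⊂ E(ℂ)` as `conjPoint`. [folklore] -/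
theorem map_subtype_map_conj {ι : K →+* ℂ} (τ : ringClassField K ι 1 ≃ₐ[ℚ] ringClassField K ι 1)
    (hτ : ∀ x : ringClassField K ι 1, ((τ x : ringClassField K ι 1) : ℂ) = starRingEnd ℂ x)
    (X : (cm7.baseChange (ringClassField K ι 1)).toAffine.Point) :
    Affine.Point.map (ringClassField K ι 1).subtype.toRatAlgHom
        (Affine.Point.map (τ : ringClassField K ι 1 →ₐ[ℚ] ringClassField K ι 1) X) =
      conjPoint cm7 (Affine.Point.map (ringClassField K ι 1).subtype.toRatAlgHom X) := by
  have hcomp : ((ringClassField K ι 1).subtype.toRatAlgHom).comp (τ : ringClassField K ι 1 →ₐ[ℚ] ringClassField K ι 1) =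
      conjRatAlgHom.comp (ringClassField K ι 1).subtype.toRatAlgHom :=
    AlgHom.ext fun x ↦ hτ x
  show _ = Affine.Point.map (W' := cm7) conjRatAlgHom
    (Affine.Point.map (ringClassField K ι 1).subtype.toRatAlgHom X)
  rw [Affine.Point.map_map, Affine.Point.map_map, hcomp]

variable (ι : K →+* ℂ) [FiniteDimensional K (ringClassField K ι 1)] [IsGalois K (ringClassField K ι 1)]

/-- **THE HALF-TRACE CONJUGATION LAW (H2): `Ψ⁻ + τΨ⁻ = O`** in `X₀(49)(K[1])`, `K = ℚ(√−2ℓ)`, `ℓ ≡ 7 (mod 8)` prime with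
`(ℓ/7) = −1`, `r₀ = √−ℓ ∈ K[1]`, `Ψ⁻ = Σ_{σ ∈ Gal(K[1]/K), σ r₀ = −r₀} σ·y(1)` the half-trace of the conductor-one Heegner point
over the non-principal genus, `τ` = complex conjugation; stated for any `DecidableEq K[1]` (the caller's point-group instance). Inputs BY NAME: `w(49a1) = +1` (`hw`), (T-φ0) (`h0`); CITED theorems:
Shimura reciprocity (ty), Gross's summed reflection law over `Cl²γ₀` (ty's FILE D), `#Cl(−8ℓ)²` even (seat c3).
[cite: Gross1984, §5 (5.2)–(5.3)] [cite: GrossLMS1991, Prop. 5.3] [cite: Darmon2004, Thm. 3.7 and Prop. 3.11] [cite: Cox2013, §3.B Thm. 3.15] -/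
theorem halfTrace_add_map_conj_eq_zero_negEightPrime (hK : IsImaginaryQuadratic K) {l : ℕ} (hl : l.Prime) (hl8 : l % 8 = 7)
    (hl7 : jacobiSym l 7 = -1) (hdK : NumberField.discr K = -(8 * (l : ℤ))) {N : ℕ} [NeZero N] (hN : cm7.conductorNorm ℤ = N)
    (D₀ : ModularParametrizationData cm7 N) (hw : cm7.rootNumber = 1) (h0 : ∃ h, D₀.cuspZeroPoint = Affine.Point.some 2 (-1) h)
    {β : ℤ} (d : KolyvaginHeegnerData D₀ β ι 1) {r₀ : ringClassField K ι 1} (hr : (r₀ : ℂ) ^ 2 = -(l : ℂ))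
    (τ : ringClassField K ι 1 ≃ₐ[ℚ] ringClassField K ι 1)
    (hτ : ∀ x : ringClassField K ι 1, ((τ x : ringClassField K ι 1) : ℂ) = starRingEnd ℂ x)
    [hdec : DecidableEq (ringClassField K ι 1)] :
    (∑ σ : ringClassField K ι 1 ≃ₐ[K] ringClassField K ι 1,
        (if σ r₀ = r₀ then (0 : ℤ) else 1) • Affine.Point.map (σ : ringClassField K ι 1 →ₐ[K] ringClassField K ι 1) d.y) +
      Affine.Point.map (τ : ringClassField K ι 1 →ₐ[ℚ] ringClassField K ι 1)
        (∑ σ : ringClassField K ι 1 ≃ₐ[K] ringClassField K ι 1,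
          (if σ r₀ = r₀ then (0 : ℤ) else 1) • Affine.Point.map (σ : ringClassField K ι 1 →ₐ[K] ringClassField K ι 1) d.y) =
      0 := by
  -- one decidability world (the statement adapts to the caller's `DecidableEq K[1]`; the proof runs in the tree's default one)
  have hworld : hdec = fun a b ↦ Subtype.instDecidableEq a b := Subsingleton.elim _ _
  subst hworld
  subst hN
  ------------------------------------------------------------------ data: level, Heegner datum, lift family, Θ, q₁
  have hl2 : l ≠ 2 := by rintro rfl; norm_num at hl8
  have hH : SatisfiesHeegnerHypothesis (cm7.conductorNorm ℤ) K := by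
    rw [conductorNorm_cm7]; exact satisfiesHeegnerHypothesis_fortyNine_negEightMul hK hl7 hdK
  have hND : ∀ p : ℕ, p.Prime → p ∣ cm7.conductorNorm ℤ → ¬ (p : ℤ) ∣ NumberField.discr K :=
    fun p hp hpN ↦ not_dvd_discr_of_satisfiesHeegnerHypothesis hK hH hp hpN
  obtain ⟨H, hHβ⟩ := nonempty_heegnerDatum_holds (cm7.conductorNorm ℤ) K hK d.dvd_sq_sub
  obtain ⟨P, Θ, hPφ, hΘ⟩ := exists_shimuraReciprocity_ringClassField_one hK hH D₀ H ι
  obtain ⟨q₁, hy⟩ := exists_rep_y_eq_of_kolyvaginHeegnerData hK d H hHβ hPφ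
  -- `σ y₁ = P_{q(σ)}`, `[𝔞_{q(σ)}] = Θ⁻¹σ · [𝔞_{q₁}]`
  choose qσ hqσ using fun σ : ringClassField K ι 1 ≃ₐ[K] ringClassField K ι 1 ↦ hΘ (Θ.symm σ) q₁
  have hqσ_map : ∀ σ : ringClassField K ι 1 ≃ₐ[K] ringClassField K ι 1,
      Affine.Point.map (σ : ringClassField K ι 1 →ₐ[K] ringClassField K ι 1) d.y = P (qσ σ) := fun σ ↦ by
    have h := (hqσ σ).2
    rw [MulEquiv.apply_symm_apply] at h
    rw [hy]; exact h
  ------------------------------------------------------------------ the genus character on `Gal(K[1]/K)`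
  have hrK := sq_eq_algebraMap_neg_natCast (ι := ι) hr
  have hd : ¬ IsSquare (-(l : K)) := not_isSquare_neg_natCast_of_discr_eq_negEightPrime hK hl hdK
  have hD4 : hK.negDiscr.D % 4 = 0 ∨ hK.negDiscr.D % 4 = 1 := Or.inl (by rw [hK.negDiscr_D, hdK]; omega)
  have hΔ : hK.negDiscr.D = -(8 * (l : ℤ)) := by rw [hK.negDiscr_D, hdK]
  have hidx : (powMonoidHom 2 : ClassGroup (OrderCl.QO hK.negDiscr) →* ClassGroup (OrderCl.QO hK.negDiscr)).range.index = 2 := by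
    rw [Literature.NumberTheory.QuadraticFields.Quadratic.index_range_sq_classGroup_QO hK.negDiscr hD4,
      assignedCharCount_neg_eight_mul_prime hK.negDiscr hl hl8 hΔ]
    norm_num
  have hχ : ∀ σ : ringClassField K ι 1 ≃ₐ[K] ringClassField K ι 1,
      σ r₀ = r₀ ↔ Θ.symm σ ∈ (powMonoidHom 2 : _ →* ClassGroup (OrderCl.QO hK.negDiscr)).range :=
    algEquiv_apply_sqrt_eq_iff_symm_mem_range_sq Θ hidx hrK hd
  obtain ⟨σ₀, hσ₀⟩ := exists_algEquiv_apply_sqrt_eq_neg hrK hd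
  have hr0 : -r₀ ≠ r₀ := by
    intro h
    have h0' : r₀ = 0 := add_self_eq_zero.mp (neg_eq_iff_add_eq_zero.mp h)
    have h3 := hr
    rw [h0'] at h3
    push_cast at h3
    have : (l : ℂ) ≠ 0 := by exact_mod_cast hl.ne_zero
    exact this (by rw [zero_pow two_ne_zero] at h3; exact neg_eq_zero.mp h3.symm)
  have hγ₁ : Θ.symm σ₀ ∉ (powMonoidHom 2 : _ →* ClassGroup (OrderCl.QO hK.negDiscr)).range :=
    fun h ↦ hr0 (hσ₀ ▸ (hχ σ₀).mpr h)
  -- `σ r₀ ≠ r₀ ⟺ [𝔞_{q(σ)}] ∈ Cl² · γ₀`, `γ₀ = Θ⁻¹σ₀ · [𝔞_{q₁}]`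
  set γ₀ : ClassGroup (OrderCl.QO hK.negDiscr) := Θ.symm σ₀ * heegnerFormClass hK (q₁ : ℤ × ℤ × ℤ) with hγ₀
  have hcoset : ∀ σ : ringClassField K ι 1 ≃ₐ[K] ringClassField K ι 1,
      σ r₀ ≠ r₀ ↔ ∃ δ, heegnerFormClass hK (qσ σ : ℤ × ℤ × ℤ) = δ ^ 2 * γ₀ := fun σ ↦ by
    rw [(hqσ σ).1, hγ₀, Ne, hχ σ]
    constructor
    · intro hσ
      have hmul : Θ.symm σ * (Θ.symm σ₀)⁻¹ ∈ (powMonoidHom 2 : _ →* ClassGroup (OrderCl.QO hK.negDiscr)).range := by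
        rw [Subgroup.mul_mem_iff_of_index_two hidx, Subgroup.inv_mem_iff]
        exact ⟨fun h ↦ absurd h hσ, fun h ↦ absurd h hγ₁⟩
      obtain ⟨δ, hδ⟩ := hmul
      refine ⟨δ, ?_⟩
      rw [← mul_assoc, ← powMonoidHom_apply, hδ, inv_mul_cancel_right]
    · rintro ⟨δ, hδ⟩ hmem
      have hδ' : Θ.symm σ = δ ^ 2 * Θ.symm σ₀ := by
        rw [← mul_assoc] at hδ; exact mul_right_cancel hδ
      apply hγ₁
      have : Θ.symm σ₀ = (δ ^ 2)⁻¹ * Θ.symm σ := by rw [hδ', inv_mul_cancel_left]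
      rw [this]
      exact mul_mem (inv_mem ⟨δ, rfl⟩) hmem
  ------------------------------------------------------------------ the complex point of `Ψ⁻` is the coset sum `z`
  have hinjq : ∀ σ σ' : ringClassField K ι 1 ≃ₐ[K] ringClassField K ι 1, qσ σ = qσ σ' → σ = σ' := by
    intro σ σ' h
    have h1 := (hqσ σ).1
    rw [h, (hqσ σ').1] at h1
    exact Θ.symm.injective (mul_right_cancel h1).symm
  have hsum : Affine.Point.map (ringClassField K ι 1).subtype.toRatAlgHom
      (∑ σ : ringClassField K ι 1 ≃ₐ[K] ringClassField K ι 1,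
        (if σ r₀ = r₀ then (0 : ℤ) else 1) • Affine.Point.map (σ : ringClassField K ι 1 →ₐ[K] ringClassField K ι 1) d.y) =
      ∑ Q ∈ H.reps.filter (fun Q ↦ ∃ δ, heegnerFormClass hK Q = δ ^ 2 * γ₀), D₀.φ (heegnerTau Q) := by
    rw [map_sum]
    have h1 : ∀ σ : ringClassField K ι 1 ≃ₐ[K] ringClassField K ι 1,
        Affine.Point.map (ringClassField K ι 1).subtype.toRatAlgHom
          ((if σ r₀ = r₀ then (0 : ℤ) else 1) • Affine.Point.map (σ : ringClassField K ι 1 →ₐ[K] ringClassField K ι 1) d.y) =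
        if σ r₀ ≠ r₀ then D₀.φ (heegnerTau (qσ σ : ℤ × ℤ × ℤ)) else 0 := fun σ ↦ by
      rw [map_zsmul, hqσ_map, hPφ]
      by_cases h : σ r₀ = r₀
      · rw [if_pos h, if_neg (not_not.mpr h), zero_zsmul]
      · rw [if_neg h, if_pos h, one_zsmul]
    simp_rw [h1]
    rw [← Finset.sum_filter]
    refine Finset.sum_nbij (fun σ ↦ (qσ σ : ℤ × ℤ × ℤ)) (fun σ hσ ↦ ?_) (fun σ hσ σ' hσ' h ↦ ?_) (fun Q hQ ↦ ?_)
      (fun _ _ ↦ rfl)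
    · rw [Finset.mem_filter] at hσ ⊢
      exact ⟨(qσ σ).2, (hcoset σ).mp hσ.2⟩
    · exact hinjq σ σ' (Subtype.ext h)
    · obtain ⟨hQ, δ, hδ⟩ := Finset.mem_filter.mp (Finset.mem_coe.mp hQ)
      -- the automorphism of class `δ²·Θ⁻¹σ₀`
      refine ⟨Θ (δ ^ 2 * Θ.symm σ₀), Finset.mem_coe.mpr (Finset.mem_filter.mpr ⟨Finset.mem_univ _, ?_⟩), ?_⟩
      · refine (hcoset _).mpr ⟨δ, ?_⟩
        rw [(hqσ _).1, MulEquiv.symm_apply_apply, hγ₀, mul_assoc]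
      · have hcl : heegnerFormClass hK (qσ (Θ (δ ^ 2 * Θ.symm σ₀)) : ℤ × ℤ × ℤ) = heegnerFormClass hK Q := by
          rw [(hqσ _).1, MulEquiv.symm_apply_apply, hδ, hγ₀, mul_assoc]
        exact heegnerFormClass_injOn_reps hK H (qσ _).2 hQ hcl
  ------------------------------------------------------------------ Gross's summed reflection law on the coset, parity
  have hW : IsFrickeEigen (cm7.conductorNorm ℤ) D₀.f (((-1 : ℤ)) : ℂ) := by
    push_cast
    exact isFrickeEigen_neg_one_of_rootNumber_eq_one cm7 D₀.isNewformOf hw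
  have hν : ∃ μ, heegnerFormClass hK ((cm7.conductorNorm ℤ : ℤ), H.β,
      (H.β ^ 2 - NumberField.discr K) / (4 * cm7.conductorNorm ℤ)) = μ ^ 2 := by
    have h7 : cm7.conductorNorm ℤ = 7 ^ 2 := by rw [conductorNorm_cm7]; norm_num
    haveI : NeZero (7 : ℕ) := ⟨by norm_num⟩
    refine ⟨_, ((heegnerFormClass_levelForm_eq_datum hK hND H q₁.2).symm.trans
      (heegnerFormClass_levelForm_eq_sq hK h7 hND (H.mem_heegnerForms _ q₁.2).1))⟩
  have hlaw := conjPoint_sum_φ_heegnerTau_sqCoset hK hH D₀ H hW (Or.inr rfl) γ₀ hν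
  have heven : Even (H.reps.filter (fun Q ↦ ∃ δ, heegnerFormClass hK Q = δ ^ 2 * γ₀)).card := by
    rw [card_filter_sqCoset_eq_natCard_range hK hH D₀ H ι γ₀]
    exact even_natCard_range_powMonoidHom_two_of_discr_eq_neg_eight_mul K hK hl hl8 hdK
  have hT0 : (H.reps.filter (fun Q ↦ ∃ δ, heegnerFormClass hK Q = δ ^ 2 * γ₀)).card • D₀.cuspZeroPoint = 0 := by
    obtain ⟨h, hh⟩ := h0
    have hh' : D₀.cuspZeroPoint = Affine.Point.some 2 (-1) (nonsingular_cm7_baseChange_two_neg_one ℂ) := hh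
    obtain ⟨k, hk⟩ := heven
    rw [hh', hk, add_nsmul, ← nsmul_add, cm7_twoTorsion_add_self ℂ, nsmul_zero]
  rw [hT0, zsmul_zero, sub_zero, neg_one_zsmul] at hlaw
  ------------------------------------------------------------------ conclusion in `E(ℂ)`
  apply Affine.Point.map_injective (f := (ringClassField K ι 1).subtype.toRatAlgHom)
  rw [map_add, map_subtype_map_conj τ hτ, hsum, hlaw, add_neg_cancel, map_zero]

end HalfTrace

end Summit.BirchSwinnertonDyer.BirchSwinnertonDyer.Theorems.GoldfeldGoodTwists

end
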